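import Summits.ResolutionOfSingularities.ResolutionOfSingularities.Theses.UniversalCells
import Summits.ResolutionOfSingularities.ResolutionOfSingularities.Theorems.UniversalCellsUniversality
import Literature.AlgebraicGeometry.Resolution.PrincipalizationToResolution
import HarnessLib

/-!
# `ProductDescent` (crux stmt-ResolutionOfSingularities-15231) is AVOIDABLE in route `UniversalCells`:
# the normalised-stratum bypass

Helper file (`--supports stmt-ResolutionOfSingularities-15231`; does not close the item — it shows
the item is not needed).

The route's assembly (`UniversalCells.closes`) reaches pointwise-local resolvability of an integral
finite-type `𝔽_p`-scheme `Y` at `y` by `Universality` (an open `W ∋ w` of `𝔸ˢ_Y` over `y` that is an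
open of a partial matroid stratum) → `MatroidCellRes` (a resolvable open `W' ∋ w`) →
`ProductDescent` (descend from `𝔸ˢ_Y` to `Y`). The last step is an open problem as stated
(existence-only descent of resolvability along `κ(y) → κ(y)(t)`: `Cruxes/ProductDescent/KERNEL.md`,
`Disproof.lean` §5, `Theorems/UniversalCellsProductDescentNormalForm.lean`).

But the PROOF of `Universality` already in the tree says much more than its statement: at every
`y ∈ Y` there is an affine open `U ∋ y` with
`Γ(Y, U) ≃+* ElemRing p N E` (`UniversalCells.elementaryChart`, Lee–Vakil §2 (a)) and
`NormRing p (Kol N) (dRow N) (config N E) ≃+* ElemRing p N E` (`stub_normalizedEncoding`, the von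
Staudt encoding on the NORMALISED stratum `[I₃ | 𝟙 | n]`, Hu 2021 Prop. 9.1), while the full stratum
is the normalised one times a split torus (`stub_torusSplitting`, Gelfand–MacPherson:
`S ≃+* Nr[λ^±, μ^±]`). So `U ≅ Spec Nr` ON THE NOSE — no affine-space factor, no descent: if the
normalised strata `Spec Nr` (for `Nr` a domain) are locally resolvable, every `Y` is pointwise
locally resolvable (`locRes_of_normStratumRes`), and with `LocalToGlobal` the route target
`PrimeFieldThesis` follows (`primeFieldThesis_of_normStratumRes`). The hypothesis "normalised strata
are locally resolvable" (stated inline below; it is what Hu's torus-equivariant tower on the chart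
`p_123 ≠ 0` of `Gr(3, n)` delivers after slicing the free torus action at the identity, and it is
implied by `MatroidCellRes ∧ ProductDescent`) is therefore a drop-in replacement for the pair
(`MatroidCellRes`, `ProductDescent`) in the assembly, removing the open descent problem from the
route at no cost. This file is the kernel-checked form of that remark, for the planners.
-/

set_option linter.dupNamespace false -- mandated namespace of this single-conjunct summit

noncomputable section

open CategoryTheory AlgebraicGeometry Literature.AlgebraicGeometry.Resolution
open Summit.ResolutionOfSingularities.ResolutionOfSingularities.Theses.UniversalCells
  (PrimeFieldThesis LocalToGlobal)
open Summit.ResolutionOfSingularities.ResolutionOfSingularities.Theorems.UniversalCells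
  (NormRing ElemRing Kol dRow config elementaryChart stub_normalizedEncoding)

namespace Summit.ResolutionOfSingularities.ResolutionOfSingularities.Theorems.ProductDescent.Bypass

/-- **Normalised-stratum bypass.** If, for every prime `p` and every elementary presentation
`(N, Eadd, Emul, Eone)` whose normalised stratum ring `Nr = NormRing p (Kol N) (dRow N) (config …)`
is a domain, `Spec Nr` is locally resolvable, then every integral scheme locally of finite type over
`𝔽_p` is pointwise locally resolvable — WITHOUT `ProductDescent`: by `elementaryChart` and
`stub_normalizedEncoding` (both in tree) every `y ∈ Y` has an affine open neighbourhood `U` with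
`Γ(Y, U) ≃+* Nr`, i.e. `U ≅ Spec Nr`; pull a resolvable open of `Spec Nr` through the image of
`y` back along this isomorphism and push it into `Y`. [cite: LeeVakil2012, Thm. 1.1, §2–3;
Hu2021, Prop. 9.1, Thm. 9.3] -/
theorem locRes_of_normStratumRes
    (hN : ∀ p : ℕ, p.Prime → ∀ (N : ℕ) (Eadd Emul : Finset (Fin N × Fin N × Fin N))
      (Eone : Finset (Fin N)),
      IsDomain (NormRing p (Kol N) (dRow N) (config N Eadd Emul Eone)) →
      ∀ x : Spec (.of (NormRing p (Kol N) (dRow N) (config N Eadd Emul Eone))),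
        ∃ V : (Spec (.of (NormRing p (Kol N) (dRow N) (config N Eadd Emul Eone)))).Opens,
          x ∈ V ∧ Scheme.HasResolution (V : Scheme.{0}))
    (p : ℕ) (hp : p.Prime) (Y : Scheme.{0}) (f : Y ⟶ Spec (.of (ZMod p)))
    [LocallyOfFiniteType f] [IsIntegral Y] (y : Y) :
    ∃ U : Y.Opens, y ∈ U ∧ Scheme.HasResolution (U : Scheme.{0}) := by
  obtain ⟨U, hU, hy, N, Eadd, Emul, Eone, ⟨e⟩⟩ := elementaryChart p hp Y f inferInstance y
  obtain ⟨e'⟩ := stub_normalizedEncoding p N Eadd Emul Eone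
  -- `Γ(Y, U) ≃+* Nr`, hence `Nr` is a domain
  let eN : Γ(Y, U) ≃+* NormRing p (Kol N) (dRow N) (config N Eadd Emul Eone) := e.trans e'.symm
  haveI : Nonempty U := ⟨⟨y, hy⟩⟩
  haveI : IsDomain (NormRing p (Kol N) (dRow N) (config N Eadd Emul Eone)) :=
    MulEquiv.isDomain Γ(Y, U) eN.symm.toMulEquiv
  -- the isomorphism `U ≅ Spec Γ(Y, U) ≅ Spec Nr`, used only as an open immersion
  let ι : (U : Scheme.{0}) ⟶ Spec (.of (NormRing p (Kol N) (dRow N) (config N Eadd Emul Eone))) :=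
    hU.isoSpec.hom ≫ Spec.map eN.symm.toCommRingCatIso.hom
  haveI : IsOpenImmersion ι := inferInstance
  -- a resolvable open of `Spec Nr` through the image of `y`, pulled back to `U`, pushed into `Y`
  obtain ⟨V, hxV, hresV⟩ := hN p hp N Eadd Emul Eone inferInstance (ι.base ⟨y, hy⟩)
  have hresV' : Scheme.HasResolution ((ι ⁻¹ᵁ V : (U : Scheme.{0}).Opens) : Scheme.{0}) :=
    Scheme.HasResolution.of_isOpenImmersion (ι ∣_ V) hresV
  refine ⟨U.ι ''ᵁ (ι ⁻¹ᵁ V), ⟨⟨y, hy⟩, hxV, rfl⟩,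
    Scheme.HasResolution.of_iso (U.ι.isoImage (ι ⁻¹ᵁ V)).hom hresV'⟩

/-- Hence the route target follows from the normalised-stratum hypothesis and `LocalToGlobal`
alone — `Universality` is consumed in its proved ring form, and neither `MatroidCellRes` nor
`ProductDescent` is invoked. [folklore] -/
theorem primeFieldThesis_of_normStratumRes
    (hN : ∀ p : ℕ, p.Prime → ∀ (N : ℕ) (Eadd Emul : Finset (Fin N × Fin N × Fin N))
      (Eone : Finset (Fin N)),
      IsDomain (NormRing p (Kol N) (dRow N) (config N Eadd Emul Eone)) →
      ∀ x : Spec (.of (NormRing p (Kol N) (dRow N) (config N Eadd Emul Eone))),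
        ∃ V : (Spec (.of (NormRing p (Kol N) (dRow N) (config N Eadd Emul Eone)))).Opens,
          x ∈ V ∧ Scheme.HasResolution (V : Scheme.{0}))
    (hL : LocalToGlobal) : PrimeFieldThesis := by
  intro p hp X f hs hl hq hi
  refine hL p hp ?_ X f hs hl hq hi
  intro Y g _ hl' _ hi' y
  haveI := hl'
  haveI := hi'
  exact locRes_of_normStratumRes hN p hp Y g y

/-- **Honesty tag, by name: the normalised-stratum hypothesis IS pointwise local resolvability over
`𝔽_p`** (the antecedent of `LocalToGlobal`, verbatim). `⟹` is `locRes_of_normStratumRes`; `⟸`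
because `Spec Nr` (for `Nr` a domain) is itself an integral, separated (affine), finite-type
`𝔽_p`-scheme — the matroid costume is transparent, exactly as the route review said of
`MatroidCellRes`. [folklore] -/
theorem normStratumRes_iff_locRes :
    (∀ p : ℕ, p.Prime → ∀ (N : ℕ) (Eadd Emul : Finset (Fin N × Fin N × Fin N))
      (Eone : Finset (Fin N)),
      IsDomain (NormRing p (Kol N) (dRow N) (config N Eadd Emul Eone)) →
      ∀ x : Spec (.of (NormRing p (Kol N) (dRow N) (config N Eadd Emul Eone))),
        ∃ V : (Spec (.of (NormRing p (Kol N) (dRow N) (config N Eadd Emul Eone)))).Opens,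
          x ∈ V ∧ Scheme.HasResolution (V : Scheme.{0})) ↔
    (∀ p : ℕ, p.Prime → ∀ (X : Scheme.{0}) (f : X ⟶ Spec (.of (ZMod p))),
      IsSeparated f → LocallyOfFiniteType f → QuasiCompact f → IsIntegral X →
      ∀ x : X, ∃ U : X.Opens, x ∈ U ∧ Scheme.HasResolution (U : Scheme.{0})) := by
  constructor
  · intro hN p hp X f _ hl _ hi x
    haveI := hl
    haveI := hi
    exact locRes_of_normStratumRes hN p hp X f x
  · intro hloc p hp N Eadd Emul Eone hdom x
    haveI := hdom
    haveI : Fact p.Prime := ⟨hp⟩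
    -- the structure morphism `Spec Nr → Spec 𝔽_p` and its finiteness properties
    let φ : CommRingCat.of (ZMod p) ⟶
        CommRingCat.of (NormRing p (Kol N) (dRow N) (config N Eadd Emul Eone)) :=
      CommRingCat.ofHom (algebraMap (ZMod p) (NormRing p (Kol N) (dRow N) (config N Eadd Emul Eone)))
    have hft : LocallyOfFiniteType (Spec.map φ) := by
      rw [HasRingHomProperty.Spec_iff (P := @LocallyOfFiniteType)]
      change RingHom.FiniteType (algebraMap (ZMod p) _)
      rw [RingHom.finiteType_algebraMap]
      infer_instance
    exact hloc p hp (Spec (.of (NormRing p (Kol N) (dRow N) (config N Eadd Emul Eone)))) (Spec.map φ)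
      inferInstance hft inferInstance inferInstance x

/-- **The re-cut assembly, paste-ready for the planner**: the summit statement from the
normalised-stratum hypothesis, `LocalToGlobal`, `PrimeFieldToPerfect` and `DescentPerfectToAll` —
the route's `closes` with the pair (`MatroidCellRes`, `ProductDescent`) replaced by the single
hypothesis NSR and `Universality` consumed in its proved ring form. [folklore] -/
theorem summit_of_normStratumRes
    (hN : ∀ p : ℕ, p.Prime → ∀ (N : ℕ) (Eadd Emul : Finset (Fin N × Fin N × Fin N))
      (Eone : Finset (Fin N)),
      IsDomain (NormRing p (Kol N) (dRow N) (config N Eadd Emul Eone)) →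
      ∀ x : Spec (.of (NormRing p (Kol N) (dRow N) (config N Eadd Emul Eone))),
        ∃ V : (Spec (.of (NormRing p (Kol N) (dRow N) (config N Eadd Emul Eone)))).Opens,
          x ∈ V ∧ Scheme.HasResolution (V : Scheme.{0}))
    (hL : LocalToGlobal)
    (hP : Summit.ResolutionOfSingularities.ResolutionOfSingularities.Theses.UniversalCells.PrimeFieldToPerfect)
    (hA : Summit.ResolutionOfSingularities.ResolutionOfSingularities.Theses.UniversalCells.DescentPerfectToAll) :
    _root_.ResolutionOfSingularities :=
  fun p hp => hA p hp (hP p hp (primeFieldThesis_of_normStratumRes hN hL p hp))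

end Summit.ResolutionOfSingularities.ResolutionOfSingularities.Theorems.ProductDescent.Bypass

end
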